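import Summits.Ventures.LatticeQCDFlow.Scoring.CalibrationTruths

/-!
# The variance of the mean of `N` correlated samples is `2 τ_N σ² / N`

HONEST FRAMING: exact (Metropolis-corrected) sampling algorithms for lattice gauge theory;
figures of merit are autocorrelation/cost numbers at stated couplings and volumes; no
continuum-physics claim.

Venture `LatticeQCDFlow` (cell pub-lqcd), sub-topic `Scoring`; FANOUT row 11 (`eng-scorerA`,
fitness scorer A: Γ-method τ_int, `Eff = Var · 2τ_int · cost`).  NEW WORK of the cell (finite sums,
one use of Mathlib's `variance_sum'`), not a published result; nothing is cited as a fact.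

## Content

`CalibrationTruths` records the convention both frozen scorers use — 'the variance of a mean of
`N` correlated samples is `2 τ_int σ² / N`, so `n_eff = N/(2 τ_int)` in chain mode' — as the
motivation of `tauInt`.  This file proves the finite-`N` statement behind it and quantifies the gap
to `τ_int`:

* `sum_sum_dist` — the pair count: for any lag function `C`,
  `∑_{i<N} ∑_{j<N} C |i − j| = N · C 0 + 2 ∑_{t=1}^{N} (N − t) · C t`;
* `variance_sum_range_of_cov_eq` — hence for square-integrable `X₀ … X_{N−1}` whose covariances
  depend on the lag only, `cov[Xᵢ, Xⱼ] = C |i − j|` (weak stationarity inside the window),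
  `Var[∑_{i<N} Xᵢ] = N · C 0 + 2 ∑_{t=1}^{N} (N − t) · C t` (via Mathlib's `variance_sum'`);
* `variance_mean_range_of_cov_eq` — with `C = σ² ρ`, `ρ 0 = 1`:
  **`Var[(1/N) ∑_{i<N} Xᵢ] = 2 τ_N σ² / N = σ² / n_eff(N, τ_N)`**, where
  `τ_N = 1/2 + ∑_{t=1}^{N} (1 − t/N) ρ t` (`tauIntN`) is the finite-`N` (Fejér-weighted) integrated
  autocorrelation time — EXACT at every `N`, no limit taken;
* `tauIntWindow_sub_tauIntN` — `τ_N` is the window-`N` value `τ_W` of `CalibrationTruths` minus the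
  Fejér correction `(1/N) ∑_{t ≤ N} t ρ t`;
* `abs_tauInt_sub_tauIntN_le` — if `M = ∑_{t ≥ 1} t |ρ t| < ∞` then `|τ_int − τ_N| ≤ M / N` for
  every `N ≥ 1`, so `τ_N → τ_int` (`tendsto_tauIntN`): the figure of merit `τ_int` IS the large-`N`
  variance of the mean in units of `σ²/(2N)`, with an `O(1/N)` definition bias;
* on the calibration family C-1 (`ρ t = r^t`) everything is in closed form:
  `τ_int − τ_N = r (1 − r^N) / (N (1 − r)²)` (`tauInt_sub_tauIntN_geometric`), strictly positive and
  `≤ r / (N (1 − r)²)`; at the hardest calibration point `r = 99/100`, `N = 10⁶` this definition bias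
  is `≤ 99/10⁴ < 10⁻⁴ · τ_int` (`C1_p99_definition_bias_1e6`) — two hundred times inside the 2 %
  acceptance band of FANOUT row 11, i.e. the band at `N = 10⁶` is limited by STATISTICS (relative
  sd of any consistent `τ̂` there ≈ 2–8 %, calibration report of record kit j121257), not by which
  finite-`N` meaning of 'analytic τ_int' one adopts;
* `F1_eq_two_mul_tau_mul_cost` / `F3_eq` — the boarded figures of merit are intensive:
  `F₁ = C_total / n_eff = 2 τ c` and `F₃ = err² · C_total = 2 τ σ² c` with `c` the measured cost per
  sample (`C_total = N c`): `N` cancels, which is what makes rows of different run lengths comparable.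
-/

namespace Summit.Ventures.LatticeQCDFlow.Scoring

open Finset MeasureTheory ProbabilityTheory
open scoped BigOperators

/-! ### The finite-`N` integrated autocorrelation time -/

/-- The finite-`N` (Fejér-weighted) integrated autocorrelation time
`τ_N = 1/2 + ∑_{t=1}^{N} (1 − t/N) ρ t`, defined so that `N · Var(x̄_N) / σ² = 2 τ_N` exactly
(`variance_mean_range_of_cov_eq`); the lag-`N` term has weight `0`. -/
noncomputable def tauIntN (ρ : ℕ → ℝ) (N : ℕ) : ℝ :=
  1 / 2 + ∑ t ∈ range N, (1 - ((t : ℝ) + 1) / N) * ρ (t + 1)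

/-- `N · 2 τ_N = N · ρ… ` bookkeeping: `N (2 τ_N) = N + 2 ∑_{t<N} (N − (t+1)) ρ (t+1)`. -/
theorem cast_mul_two_mul_tauIntN (ρ : ℕ → ℝ) {N : ℕ} (hN : N ≠ 0) :
    (N : ℝ) * (2 * tauIntN ρ N) = N + 2 * ∑ t ∈ range N, ((N : ℝ) - (t + 1)) * ρ (t + 1) := by
  have hN' : (N : ℝ) ≠ 0 := by exact_mod_cast hN
  have hS : (N : ℝ) * ∑ t ∈ range N, (1 - ((t : ℝ) + 1) / N) * ρ (t + 1)
      = ∑ t ∈ range N, ((N : ℝ) - (t + 1)) * ρ (t + 1) := by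
    rw [Finset.mul_sum]
    refine Finset.sum_congr rfl fun t _ => ?_
    field_simp
  calc (N : ℝ) * (2 * tauIntN ρ N)
      = N + 2 * ((N : ℝ) * ∑ t ∈ range N, (1 - ((t : ℝ) + 1) / N) * ρ (t + 1)) := by
        unfold tauIntN; ring
    _ = N + 2 * ∑ t ∈ range N, ((N : ℝ) - (t + 1)) * ρ (t + 1) := by rw [hS]

/-- `τ_N` versus the window-`N` truncated sum `τ_W` of `CalibrationTruths`:
`τ_W(N) − τ_N = (1/N) ∑_{t=1}^{N} t ρ t` (the Fejér correction). -/
theorem tauIntWindow_sub_tauIntN (ρ : ℕ → ℝ) (N : ℕ) :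
    tauIntWindow ρ N - tauIntN ρ N = (∑ t ∈ range N, ((t : ℝ) + 1) * ρ (t + 1)) / N := by
  unfold tauIntWindow tauIntN
  rw [Finset.sum_div]
  have : ∀ t ∈ range N,
      (1 - ((t : ℝ) + 1) / N) * ρ (t + 1) = ρ (t + 1) - ((t : ℝ) + 1) * ρ (t + 1) / N := by
    intro t _
    ring
  rw [Finset.sum_congr rfl this, Finset.sum_sub_distrib]
  ring

/-! ### The pair count and the variance of a sum of weakly stationary samples -/

/-- Lags to the new right end-point: `∑_{i<N} C (dist i N) = ∑_{s<N} C (s+1)`. -/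
theorem sum_range_dist_right (C : ℕ → ℝ) (N : ℕ) :
    ∑ i ∈ range N, C (Nat.dist i N) = ∑ s ∈ range N, C (s + 1) := by
  rw [← Finset.sum_range_reflect (fun s => C (s + 1)) N]
  refine Finset.sum_congr rfl fun i hi => ?_
  have hi' : i < N := Finset.mem_range.mp hi
  rw [Nat.dist_eq_sub_of_le hi'.le]
  congr 1
  omega

/-- **Pair count.**  For any lag function `C : ℕ → ℝ`,
`∑_{i<N} ∑_{j<N} C |i − j| = N · C 0 + 2 ∑_{t<N} (N − (t+1)) · C (t+1)`
(`N` diagonal pairs, `2 (N − t)` ordered pairs at lag `t ≥ 1`). -/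
theorem sum_sum_dist (C : ℕ → ℝ) : ∀ N : ℕ,
    ∑ i ∈ range N, ∑ j ∈ range N, C (Nat.dist i j)
      = N * C 0 + 2 * ∑ t ∈ range N, ((N : ℝ) - (t + 1)) * C (t + 1)
  | 0 => by simp
  | N + 1 => by
    have IH := sum_sum_dist C N
    have hcol : ∑ i ∈ range N, C (Nat.dist i N) = ∑ s ∈ range N, C (s + 1) :=
      sum_range_dist_right C N
    have hrow : ∑ j ∈ range N, C (Nat.dist N j) = ∑ s ∈ range N, C (s + 1) := by
      rw [← hcol]
      exact Finset.sum_congr rfl fun j _ => by rw [Nat.dist_comm]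
    have key : ∑ t ∈ range N, (((N + 1 : ℕ) : ℝ) - (t + 1)) * C (t + 1)
        = ∑ t ∈ range N, ((N : ℝ) - (t + 1)) * C (t + 1) + ∑ t ∈ range N, C (t + 1) := by
      rw [← Finset.sum_add_distrib]
      refine Finset.sum_congr rfl fun t _ => ?_
      push_cast
      ring
    rw [Finset.sum_range_succ]
    simp_rw [Finset.sum_range_succ]
    rw [Finset.sum_add_distrib, IH, hrow, hcol, Nat.dist_self, key]
    push_cast
    ring

section Variance

variable {Ω : Type*} {mΩ : MeasurableSpace Ω} {μ : Measure Ω} [IsFiniteMeasure μ]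

/-- **Variance of a sum of weakly stationary samples.**  If `X₀, …, X_{N−1}` are square
integrable and their covariances depend on the lag only, `cov[Xᵢ, Xⱼ] = C |i − j|` for
`i, j < N`, then `Var[∑_{i<N} Xᵢ] = N · C 0 + 2 ∑_{t<N} (N − (t+1)) · C (t+1)`. -/
theorem variance_sum_range_of_cov_eq (X : ℕ → Ω → ℝ) (C : ℕ → ℝ) (N : ℕ)
    (hX : ∀ i < N, MemLp (X i) 2 μ)
    (hC : ∀ i < N, ∀ j < N, cov[X i, X j; μ] = C (Nat.dist i j)) :
    Var[∑ i ∈ range N, X i; μ]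
      = N * C 0 + 2 * ∑ t ∈ range N, ((N : ℝ) - (t + 1)) * C (t + 1) := by
  rw [variance_sum' (fun i hi => hX i (Finset.mem_range.mp hi)), ← sum_sum_dist C N]
  refine Finset.sum_congr rfl fun i hi => Finset.sum_congr rfl fun j hj => ?_
  exact hC i (Finset.mem_range.mp hi) j (Finset.mem_range.mp hj)

/-- **The variance of the mean of `N` correlated samples is `2 τ_N σ² / N`.**  With variance `σ²`
and a lag-only normalised autocorrelation `ρ` (`ρ 0 = 1`, `cov[Xᵢ, Xⱼ] = σ² ρ |i − j|` for
`i, j < N`, `N ≥ 1`):  `Var[(1/N) ∑_{i<N} Xᵢ] = 2 τ_N(ρ) σ² / N`, exactly, at every `N`. -/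
theorem variance_mean_range_of_cov_eq (X : ℕ → Ω → ℝ) (σ2 : ℝ) (ρ : ℕ → ℝ) (hρ : ρ 0 = 1)
    {N : ℕ} (hN : N ≠ 0) (hX : ∀ i < N, MemLp (X i) 2 μ)
    (hC : ∀ i < N, ∀ j < N, cov[X i, X j; μ] = σ2 * ρ (Nat.dist i j)) :
    Var[fun ω => (∑ i ∈ range N, X i ω) / N; μ] = 2 * tauIntN ρ N * σ2 / N := by
  have hN' : (N : ℝ) ≠ 0 := by exact_mod_cast hN
  have h1 : (fun ω => (∑ i ∈ range N, X i ω) / N)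
      = fun ω => (∑ i ∈ range N, X i ω) * (N : ℝ)⁻¹ := by
    funext ω; rw [div_eq_mul_inv]
  have hsum : Var[fun ω => ∑ i ∈ range N, X i ω; μ]
      = N * (σ2 * ρ 0) + 2 * ∑ t ∈ range N, ((N : ℝ) - (t + 1)) * (σ2 * ρ (t + 1)) := by
    rw [variance_fun_sum' (fun i hi => hX i (Finset.mem_range.mp hi)),
      ← sum_sum_dist (fun t => σ2 * ρ t) N]
    refine Finset.sum_congr rfl fun i hi => Finset.sum_congr rfl fun j hj => ?_
    exact hC i (Finset.mem_range.mp hi) j (Finset.mem_range.mp hj)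
  have hτ := cast_mul_two_mul_tauIntN ρ hN
  rw [h1, variance_mul_const, hsum, hρ]
  have h2 : ∑ t ∈ range N, ((N : ℝ) - (t + 1)) * (σ2 * ρ (t + 1))
      = σ2 * ∑ t ∈ range N, ((N : ℝ) - (t + 1)) * ρ (t + 1) := by
    rw [Finset.mul_sum]
    exact Finset.sum_congr rfl fun t _ => by ring
  have h3 : (N : ℝ) * (σ2 * 1) + 2 * (σ2 * ∑ t ∈ range N, ((N : ℝ) - (t + 1)) * ρ (t + 1))
      = σ2 * ((N : ℝ) * (2 * tauIntN ρ N)) := by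
    rw [hτ]; ring
  have hinv : (N : ℝ) * ((N : ℝ)⁻¹) ^ 2 = (N : ℝ)⁻¹ := by
    rw [inv_pow, pow_two, mul_inv, ← mul_assoc, mul_inv_cancel₀ hN', one_mul]
  rw [h2, h3]
  calc σ2 * ((N : ℝ) * (2 * tauIntN ρ N)) * ((N : ℝ)⁻¹) ^ 2
      = σ2 * (2 * tauIntN ρ N) * ((N : ℝ) * ((N : ℝ)⁻¹) ^ 2) := by ring
    _ = 2 * tauIntN ρ N * σ2 / N := by rw [hinv, div_eq_mul_inv]; ring

/-- The same statement read as an effective sample count: `Var[x̄_N] = σ² / n_eff` with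
`n_eff = N / (2 τ_N)` (`CalibrationTruths.nEffChain`) — the mean of `N` correlated samples is worth
`N/(2 τ_N)` independent ones (`τ_N ≠ 0`). -/
theorem variance_mean_eq_div_nEffChain (X : ℕ → Ω → ℝ) (σ2 : ℝ) (ρ : ℕ → ℝ) (hρ : ρ 0 = 1)
    {N : ℕ} (hN : N ≠ 0) (hτ : tauIntN ρ N ≠ 0) (hX : ∀ i < N, MemLp (X i) 2 μ)
    (hC : ∀ i < N, ∀ j < N, cov[X i, X j; μ] = σ2 * ρ (Nat.dist i j)) :
    Var[fun ω => (∑ i ∈ range N, X i ω) / N; μ] = σ2 / nEffChain N (tauIntN ρ N) := by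
  rw [variance_mean_range_of_cov_eq X σ2 ρ hρ hN hX hC, nEffChain]
  have hN' : (N : ℝ) ≠ 0 := by exact_mod_cast hN
  field_simp

end Variance

/-! ### `τ_N → τ_int` with an `O(1/N)` bias -/

/-- Summability of the lags from summability of the first absolute moment of the ACF. -/
theorem summable_succ_of_summable_moment {ρ : ℕ → ℝ}
    (h : Summable fun t : ℕ => ((t : ℝ) + 1) * |ρ (t + 1)|) :
    Summable fun t : ℕ => ρ (t + 1) := by
  refine Summable.of_norm_bounded h fun t => ?_
  rw [Real.norm_eq_abs]
  have h0 : 0 ≤ |ρ (t + 1)| := abs_nonneg _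
  have h1 : (1 : ℝ) ≤ (t : ℝ) + 1 := by
    have : (0 : ℝ) ≤ t := Nat.cast_nonneg t
    linarith
  nlinarith

/-- **Definition bias of `τ_N`.**  If the first absolute moment of the autocorrelation function is
finite, `M = ∑_{t ≥ 1} t |ρ t| < ∞`, then for every `N ≥ 1`
`|τ_int − τ_N| ≤ M / N`: the tail beyond lag `N` and the Fejér correction are each paid for by
`M/N`. -/
theorem abs_tauInt_sub_tauIntN_le {ρ : ℕ → ℝ}
    (h : Summable fun t : ℕ => ((t : ℝ) + 1) * |ρ (t + 1)|) {N : ℕ} (hN : N ≠ 0) :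
    |tauInt ρ - tauIntN ρ N| ≤ (∑' t : ℕ, ((t : ℝ) + 1) * |ρ (t + 1)|) / N := by
  have hN' : (0 : ℝ) < N := by exact_mod_cast Nat.pos_of_ne_zero hN
  have hsρ : Summable fun t : ℕ => ρ (t + 1) := summable_succ_of_summable_moment h
  -- split the lag series at `N`
  have hsplit : ∑' t : ℕ, ρ (t + 1) = ∑ t ∈ range N, ρ (t + 1) + ∑' t : ℕ, ρ (t + N + 1) := by
    rw [← hsρ.sum_add_tsum_nat_add N]
  have hMsplit : ∑' t : ℕ, ((t : ℝ) + 1) * |ρ (t + 1)|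
      = ∑ t ∈ range N, ((t : ℝ) + 1) * |ρ (t + 1)|
        + ∑' t : ℕ, (((t + N : ℕ) : ℝ) + 1) * |ρ (t + N + 1)| := by
    rw [← h.sum_add_tsum_nat_add N]
  -- the difference, explicitly
  have hdiff : tauInt ρ - tauIntN ρ N
      = ∑' t : ℕ, ρ (t + N + 1) + (∑ t ∈ range N, ((t : ℝ) + 1) * ρ (t + 1)) / N := by
    have hw := tauIntWindow_sub_tauIntN ρ N
    have : tauInt ρ - tauIntWindow ρ N = ∑' t : ℕ, ρ (t + N + 1) := by
      unfold tauInt tauIntWindow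
      rw [hsplit]
      ring
    linarith
  -- tail bound: `|∑_{t ≥ N+1} ρ t| ≤ (1/N) ∑_{t ≥ N+1} t |ρ t|`
  have htail_summable : Summable fun t : ℕ => (((t + N : ℕ) : ℝ) + 1) * |ρ (t + N + 1)| :=
    (summable_nat_add_iff N).mpr h
  have htail_abs : Summable fun t : ℕ => |ρ (t + N + 1)| :=
    ((summable_nat_add_iff N).mpr hsρ).abs
  have htail : |∑' t : ℕ, ρ (t + N + 1)| ≤ (∑' t : ℕ, (((t + N : ℕ) : ℝ) + 1) * |ρ (t + N + 1)|) / N := by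
    calc |∑' t : ℕ, ρ (t + N + 1)| ≤ ∑' t : ℕ, |ρ (t + N + 1)| := by
          have := norm_tsum_le_tsum_norm ((summable_nat_add_iff N).mpr hsρ).norm
          simpa only [Real.norm_eq_abs] using this
      _ ≤ ∑' t : ℕ, (((t + N : ℕ) : ℝ) + 1) * |ρ (t + N + 1)| / N := by
          refine Summable.tsum_le_tsum (fun t => ?_) htail_abs (htail_summable.div_const _)
          rw [le_div_iff₀ hN']
          have h0 : 0 ≤ |ρ (t + N + 1)| := abs_nonneg _
          have h1 : (N : ℝ) ≤ ((t + N : ℕ) : ℝ) + 1 := by push_cast; linarith [Nat.cast_nonneg (α := ℝ) t]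
          nlinarith
      _ = (∑' t : ℕ, (((t + N : ℕ) : ℝ) + 1) * |ρ (t + N + 1)|) / N := tsum_div_const
  -- Fejér-correction bound
  have hfejer : |(∑ t ∈ range N, ((t : ℝ) + 1) * ρ (t + 1)) / N|
      ≤ (∑ t ∈ range N, ((t : ℝ) + 1) * |ρ (t + 1)|) / N := by
    rw [abs_div, abs_of_pos hN', div_le_div_iff_of_pos_right hN']
    refine (Finset.abs_sum_le_sum_abs _ _).trans (le_of_eq ?_)
    refine Finset.sum_congr rfl fun t _ => ?_
    rw [abs_mul, abs_of_nonneg (by positivity : (0 : ℝ) ≤ (t : ℝ) + 1)]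
  rw [hdiff, hMsplit, add_div]
  exact (abs_add_le _ _).trans (by linarith [htail, hfejer])

/-- Hence `τ_N → τ_int`: the figure of merit `τ_int` is the large-`N` variance of the mean in units
of `σ² / (2N)`. -/
theorem tendsto_tauIntN {ρ : ℕ → ℝ} (h : Summable fun t : ℕ => ((t : ℝ) + 1) * |ρ (t + 1)|) :
    Filter.Tendsto (fun N => tauIntN ρ N) Filter.atTop (nhds (tauInt ρ)) := by
  set M : ℝ := ∑' t : ℕ, ((t : ℝ) + 1) * |ρ (t + 1)|
  have hlim : Filter.Tendsto (fun N : ℕ => M / (N : ℝ)) Filter.atTop (nhds 0) :=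
    tendsto_const_div_atTop_nhds_zero_nat M
  rw [tendsto_iff_norm_sub_tendsto_zero]
  refine squeeze_zero' (Filter.Eventually.of_forall fun N => norm_nonneg _) ?_ hlim
  filter_upwards [Filter.eventually_ne_atTop 0] with N hN
  rw [Real.norm_eq_abs, abs_sub_comm]
  exact abs_tauInt_sub_tauIntN_le h hN

/-! ### Closed form on the calibration family C-1 (`ρ t = r^t`) -/

/-- The finite arithmetico-geometric sum:
`(1 − r)² ∑_{t=1}^{N} t r^t = r (1 − (N+1) r^N + N r^(N+1))`. -/
theorem one_sub_sq_mul_sum_mul_pow (r : ℝ) : ∀ N : ℕ,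
    (1 - r) ^ 2 * ∑ t ∈ range N, ((t : ℝ) + 1) * r ^ (t + 1)
      = r * (1 - (N + 1) * r ^ N + N * r ^ (N + 1))
  | 0 => by simp
  | N + 1 => by
    rw [Finset.sum_range_succ, mul_add, one_sub_sq_mul_sum_mul_pow r N]
    push_cast
    ring

/-- **Finite-`N` definition bias on C-1, closed form.**  For `|r| < 1` and `N ≥ 1`,
`τ_int − τ_N = r (1 − r^N) / (N (1 − r)²)` for the geometric ACF `ρ t = r^t`. -/
theorem tauInt_sub_tauIntN_geometric {r : ℝ} (hr : |r| < 1) {N : ℕ} (hN : N ≠ 0) :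
    tauInt (fun t => r ^ t) - tauIntN (fun t => r ^ t) N
      = r * (1 - r ^ N) / (N * (1 - r) ^ 2) := by
  have hr1 : r ≠ 1 := ne_of_lt (abs_lt.mp hr).2
  have h1 : (1 : ℝ) - r ≠ 0 := sub_ne_zero.mpr (Ne.symm hr1)
  have hN' : (N : ℝ) ≠ 0 := by exact_mod_cast hN
  have hA := one_sub_sq_mul_sum_mul_pow r N
  have hW := tauInt_sub_tauIntWindow_geometric hr N
  have hF := tauIntWindow_sub_tauIntN (fun t => r ^ t) N
  -- eliminate the window value and the finite sum
  have hS : ∑ t ∈ range N, ((t : ℝ) + 1) * r ^ (t + 1)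
      = r * (1 - (N + 1) * r ^ N + N * r ^ (N + 1)) / (1 - r) ^ 2 := by
    rw [← hA]; field_simp
  rw [hS] at hF
  have : tauInt (fun t => r ^ t) - tauIntN (fun t => r ^ t) N
      = r ^ (N + 1) / (1 - r) + r * (1 - (N + 1) * r ^ N + N * r ^ (N + 1)) / (1 - r) ^ 2 / N := by
    linarith
  rw [this]
  field_simp
  ring

/-- On C-1 with `0 < r < 1` the finite-`N` definition UNDER-states `τ_int` (`τ_N < τ_int`). -/
theorem tauIntN_lt_tauInt_geometric {r : ℝ} (hr0 : 0 < r) (hr1 : r < 1) {N : ℕ} (hN : N ≠ 0) :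
    tauIntN (fun t => r ^ t) N < tauInt (fun t => r ^ t) := by
  have habs : |r| < 1 := abs_lt.mpr ⟨by linarith, hr1⟩
  have h := tauInt_sub_tauIntN_geometric habs hN
  have hN' : (0 : ℝ) < N := by exact_mod_cast Nat.pos_of_ne_zero hN
  have hpos : 0 < r * (1 - r ^ N) / (N * (1 - r) ^ 2) := by
    apply div_pos (mul_pos hr0 (by nlinarith [pow_lt_one₀ hr0.le hr1 hN]))
    exact mul_pos hN' (by nlinarith)
  linarith

/-- … by at most `r / (N (1 − r)²)` (`= M/N` with `M = ∑ t r^t`, the general bound, up to the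
factor `1 − r^N`). -/
theorem tauInt_sub_tauIntN_geometric_le {r : ℝ} (hr0 : 0 ≤ r) (hr1 : r < 1) {N : ℕ}
    (hN : N ≠ 0) :
    tauInt (fun t => r ^ t) - tauIntN (fun t => r ^ t) N ≤ r / (N * (1 - r) ^ 2) := by
  have habs : |r| < 1 := abs_lt.mpr ⟨by linarith, hr1⟩
  rw [tauInt_sub_tauIntN_geometric habs hN]
  have hN' : (0 : ℝ) < N := by exact_mod_cast Nat.pos_of_ne_zero hN
  have hden : 0 < (N : ℝ) * (1 - r) ^ 2 := mul_pos hN' (by nlinarith)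
  rw [div_le_div_iff_of_pos_right hden]
  have : 0 ≤ r ^ N := pow_nonneg hr0 N
  nlinarith

/-- **C-1 at the hardest calibration point.**  `r = 99/100` (`τ_int = 199/2`), `N = 10⁶`:
`0 < τ_int − τ_N ≤ 99/10⁴`, i.e. below `10⁻⁴ · τ_int` — the finite-`N` meaning of 'analytic
τ_int' moves the target by two hundred times less than the 2 % acceptance band (1.99 vs 0.0099). -/
theorem C1_p99_definition_bias_1e6 :
    0 < tauInt (fun t => (99 / 100 : ℝ) ^ t) - tauIntN (fun t => (99 / 100 : ℝ) ^ t) (10 ^ 6)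
    ∧ tauInt (fun t => (99 / 100 : ℝ) ^ t) - tauIntN (fun t => (99 / 100 : ℝ) ^ t) (10 ^ 6)
        ≤ 99 / 10 ^ 4 := by
  refine ⟨?_, ?_⟩
  · have := tauIntN_lt_tauInt_geometric (r := 99 / 100) (by norm_num) (by norm_num)
      (N := 10 ^ 6) (by norm_num)
    linarith
  · have := tauInt_sub_tauIntN_geometric_le (r := 99 / 100) (by norm_num) (by norm_num)
      (N := 10 ^ 6) (by norm_num)
    refine this.trans (le_of_eq ?_)
    norm_num

/-! ### The figures of merit are intensive (`N` cancels) -/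

/-- `F₁ = C_total / n_eff` with `C_total = N · c` (`c` = measured cost per sample) and
`n_eff = N / (2τ)`:  `F₁ = 2 τ c`. -/
theorem F1_eq_two_mul_tau_mul_cost (N τ c : ℝ) (hN : N ≠ 0) (hτ : τ ≠ 0) :
    N * c / nEffChain N τ = 2 * τ * c := by
  unfold nEffChain
  field_simp

/-- `F₃ = err(Ō)² · C_total` with `err² = Var[x̄_N] = 2 τ σ² / N` and `C_total = N · c`:
`F₃ = 2 τ σ² c` ('Eff = Var · 2τ_int · cost' of the FANOUT row). -/
theorem F3_eq (N τ σ2 c : ℝ) (hN : N ≠ 0) :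
    2 * τ * σ2 / N * (N * c) = 2 * τ * σ2 * c := by
  field_simp

end Summit.Ventures.LatticeQCDFlow.Scoring
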